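import Summits.ResolutionOfSingularities.ResolutionOfSingularities.Theorems.WeightedInvariantIota3SigmaAscent
import Summits.ResolutionOfSingularities.ResolutionOfSingularities.Theorems.WeightedInvariantP3bDrop
import Mathlib.RingTheory.AdicCompletion.LocalRing
import Mathlib.RingTheory.AdicCompletion.AsTensorProduct
import HarnessLib

/-!
# DESCENT of the flag-slope letters `σ` along DENSE flat local maps (completions): reached weights, `σ`, and σ-maximising
# flags are FORMAL

Route `ResolutionOfSingularities/WeightedInvariant`, door crux `HypersurfaceCentreConstruction` (stmt-ResolutionOfSingularities-19897), P3 rung;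
the completion seam of the (K-wild-hom) memo (`plan/tools/res-type-060/o50/K-WILD-HOM.md` §6, OPEN item 3) — res-type-060 (gen 10).  Over
res-type-057's (o39) `…Iota3SigmaAscent` (ASCENT along flat algebras of local rings with `𝔪S′ = 𝔪′`; its header names DESCENT as «the open half»
and records the `…_of_descent` equalities).  [OURS · L1 W4.3 · helper, counted 0] — bookkeeping on OUR letters; AI proof, weaker than expert review.

THE CLASS OF MAPS: `S → S′` an algebra of local rings, `Module.Flat S S′`, `(𝔪_S)·S′ = 𝔪_{S′}` (`hm`, as in (o39)) AND DENSE: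
`∀ n y, ∃ x, y − x·1 ∈ 𝔪′ⁿ` (`hdense`) — the `𝔪`-adic completion `S → Ŝ` of a Noetherian local ring (§3, Mathlib `AdicCompletion`), and through a
ring isomorphism any Cohen model `Ŝ ≅ K⟦X₁, …, X_d⟧`.

## Content

§1 (any local ring) **jets lemma for the two-flag filtration**: flags congruent modulo `𝔪ᴺ`, `N ≥ n`, have the same degree-`n` piece
(`flagContactFiltration_le/eq_of_sub_mem_pow`).
§2 (the class above) `IsTwoFlag.of_sub_mem_sq` (a two-flag upstairs congruent mod `𝔪′²` to the image of a pair downstairs makes that pair a two-flag),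
`exists_flagContactFiltration_eq_map_of_dense` (every upstairs piece is extended from downstairs), **`FlagReaches.of_dense`** (DESCENT of reached
weights), hence `flagReaches_algebraMap_iff_of_dense` and the letters are PRESERVED: `sigmaRatioNat/levelSet/sigmaLevelNat/iotaSigma_algebraMap_eq_of_dense`
((o39)'s `_of_descent` lemmas discharged); `IsSigmaMaximiser.algebraMap_iff_of_dense` and `exists_isSigmaMaximiser_of_dense` (a σ-maximising flag
upstairs is approximated to any order by the image of a σ-maximising flag downstairs).
§3 the instance: `S → AdicCompletion (maximalIdeal S) S` for `S` Noetherian local is in the class (`adicCompletion_dense`, `iotaSigma_adicCompletion_eq`,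
`flagReaches_adicCompletion_iff`).

Use: the K1 certificate (`KWildHom.k1_not_mem_flagContactFiltration_of_two_mul_lt`, in `K⟦T,X,Z⟧`) and power-series σ-computations ((o56)(b′))
become statements about the local ring itself once a Cohen isomorphism of the completion is in hand.
[cite: Matsumura1987, Thm. 8.10, Thm. 8.14 (completion of a Noetherian local ring: faithfully flat, `𝔪Ŝ = 𝔪̂`, `S/𝔪ⁿ = Ŝ/𝔪̂ⁿ`)]
-/

noncomputable section

set_option linter.dupNamespace false -- mandated namespace of this single-conjunct summit

open IsLocalRing Literature.AlgebraicGeometry.Resolution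
open Summit.ResolutionOfSingularities.ResolutionOfSingularities.Theorems

namespace Summit.ResolutionOfSingularities.ResolutionOfSingularities.Cruxes.HypersurfaceCentreConstruction.LocalEngine

namespace Iota3

universe u

/-! ## §1 Jets lemma for the two-flag filtration -/

section Jets

variable {S : Type u} [CommRing S]

/-- Monomials in congruent pairs are congruent. [folklore] -/
theorem pow_mul_pow_sub_mem_of_sub_mem {I : Ideal S} {a a' b b' : S} (ha : a - a' ∈ I) (hb : b - b' ∈ I) (α β : ℕ) :
    a ^ α * b ^ β - a' ^ α * b' ^ β ∈ I := by
  rw [← Ideal.Quotient.eq] at ha hb ⊢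
  simp only [map_mul, map_pow, ha, hb]

variable [IsLocalRing S]

/-- The exponent of the flag-free piece is at most the degree: `⌈n/q⌉ ≤ n` (and `= 0` for `q = 0`). [folklore] -/
theorem flag_exponent_zero_le (q n : ℕ) : (n + q - 1) / q ≤ n := by
  rcases Nat.eq_zero_or_pos q with rfl | hq
  · simp
  · have h1 : n ≤ n * q := Nat.le_mul_of_pos_right n hq
    have h3 : (n + 1) * q = n * q + q := by ring
    have h2 : (n + q - 1) / q < n + 1 := (Nat.div_lt_iff_lt_mul hq).mpr (by rw [h3]; omega)
    omega

/-- `𝔪ᴺ` lies in every degree-`n` piece for `N ≥ n` (the flag-free piece `𝔪^⌈n/q⌉`). [folklore] -/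
theorem maximalIdeal_pow_le_flagContactFiltration (g₁ g₂ : S) (q r₁ r₂ : ℕ) {n N : ℕ} (hN : n ≤ N) :
    maximalIdeal S ^ N ≤ flagContactFiltration g₁ g₂ q r₁ r₂ n := by
  rw [flagContactFiltration_def]
  refine le_iSup_of_le 0 (le_iSup_of_le 0 ?_)
  rw [pow_zero, pow_zero, mul_one, Ideal.span_singleton_one, Ideal.top_mul, Nat.mul_zero, Nat.mul_zero, Nat.sub_zero, Nat.sub_zero]
  exact Ideal.pow_le_pow_right ((flag_exponent_zero_le q n).trans hN)

/-- **Jets lemma for the two-flag filtration (one inclusion)**: if `g₁ ≡ g₁′`, `g₂ ≡ g₂′ (mod 𝔪ᴺ)` with `N ≥ n` then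
`F_{g₁,g₂}(n) ⊆ F_{g₁′,g₂′}(n)` (same weights). [folklore] -/
theorem flagContactFiltration_le_of_sub_mem_pow {g₁ g₂ g₁' g₂' : S} {n N : ℕ} (hN : n ≤ N)
    (h₁ : g₁ - g₁' ∈ maximalIdeal S ^ N) (h₂ : g₂ - g₂' ∈ maximalIdeal S ^ N) (q r₁ r₂ : ℕ) :
    flagContactFiltration g₁ g₂ q r₁ r₂ n ≤ flagContactFiltration g₁' g₂' q r₁ r₂ n := by
  rw [flagContactFiltration_def g₁ g₂]
  refine iSup_le fun α => iSup_le fun β => ?_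
  have hδ := pow_mul_pow_sub_mem_of_sub_mem h₁ h₂ α β
  have hpiece : Ideal.span {g₁' ^ α * g₂' ^ β} * maximalIdeal S ^ ((n - r₁ * α - r₂ * β + q - 1) / q) ≤
      flagContactFiltration g₁' g₂' q r₁ r₂ n := by
    rw [flagContactFiltration_def]
    exact le_iSup_of_le α (le_iSup_of_le β le_rfl)
  refine le_trans ?_ (sup_le hpiece (maximalIdeal_pow_le_flagContactFiltration g₁' g₂' q r₁ r₂ hN))
  rw [Ideal.mul_le]
  intro r hr s hs
  obtain ⟨c, rfl⟩ := Ideal.mem_span_singleton'.mp hr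
  have hsplit : c * (g₁ ^ α * g₂ ^ β) * s = c * (g₁' ^ α * g₂' ^ β) * s + c * s * (g₁ ^ α * g₂ ^ β - g₁' ^ α * g₂' ^ β) := by
    ring
  rw [hsplit]
  exact Ideal.add_mem _ (Ideal.mem_sup_left (Ideal.mul_mem_mul (Ideal.mem_span_singleton'.mpr ⟨c, rfl⟩) hs))
    (Ideal.mem_sup_right (Ideal.mul_mem_left _ _ hδ))

/-- **Jets lemma for the two-flag filtration**: flags congruent modulo `𝔪ᴺ`, `N ≥ n`, have the same degree-`n` piece. [folklore] -/
theorem flagContactFiltration_eq_of_sub_mem_pow {g₁ g₂ g₁' g₂' : S} {n N : ℕ} (hN : n ≤ N)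
    (h₁ : g₁ - g₁' ∈ maximalIdeal S ^ N) (h₂ : g₂ - g₂' ∈ maximalIdeal S ^ N) (q r₁ r₂ : ℕ) :
    flagContactFiltration g₁ g₂ q r₁ r₂ n = flagContactFiltration g₁' g₂' q r₁ r₂ n :=
  le_antisymm (flagContactFiltration_le_of_sub_mem_pow hN h₁ h₂ q r₁ r₂)
    (flagContactFiltration_le_of_sub_mem_pow hN (by rw [← neg_sub]; exact (maximalIdeal S ^ N).neg_mem h₁)
      (by rw [← neg_sub]; exact (maximalIdeal S ^ N).neg_mem h₂) q r₁ r₂)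

end Jets

/-! ## §2 Dense flat local algebras with `𝔪S′ = 𝔪′`: descent -/

section Dense

variable {S S' : Type u} [CommRing S] [CommRing S'] [IsLocalRing S] [IsLocalRing S'] [Algebra S S'] [Module.Flat S S']
  (hm : (maximalIdeal S).map (algebraMap S S') = maximalIdeal S')

include hm

/-- **Two-flags descend along approximations**: a two-flag `(g₁, g₂)` upstairs with `gᵢ ≡ Gᵢ·1 (mod 𝔪′²)` makes `(G₁, G₂)` a two-flag
downstairs. [folklore] -/
theorem IsTwoFlag.of_sub_mem_sq {g₁ g₂ : S'} (h : IsTwoFlag g₁ g₂) {G₁ G₂ : S}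
    (h₁ : g₁ - algebraMap S S' G₁ ∈ maximalIdeal S' ^ 2) (h₂ : g₂ - algebraMap S S' G₂ ∈ maximalIdeal S' ^ 2) :
    IsTwoFlag G₁ G₂ := by
  have hsq : maximalIdeal S' ^ 2 ≤ maximalIdeal S' := Ideal.pow_le_self two_ne_zero
  have hone : ∀ a : S, algebraMap S S' a ∈ maximalIdeal S' → a ∈ maximalIdeal S := fun a ha => by
    have := (mem_maximalIdeal_pow_iff_of_flat hm a 1).mpr (by rwa [pow_one])
    rwa [pow_one] at this
  have hmem : ∀ {g : S'} {G : S}, g ∈ maximalIdeal S' → g - algebraMap S S' G ∈ maximalIdeal S' ^ 2 → G ∈ maximalIdeal S :=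
    fun {g G} hg hgG => hone G (by
      have : algebraMap S S' G = g - (g - algebraMap S S' G) := by ring
      rw [this]
      exact Ideal.sub_mem _ hg (hsq hgG))
  refine ⟨hmem h.1 h₁, hmem h.2.1 h₂, fun a b hab => ?_⟩
  have hup : algebraMap S S' (a * G₁ + b * G₂) ∈ maximalIdeal S' ^ 2 := (mem_maximalIdeal_pow_iff_of_flat hm _ 2).mp hab
  have hsplit : algebraMap S S' a * g₁ + algebraMap S S' b * g₂ = algebraMap S S' (a * G₁ + b * G₂) +
      (algebraMap S S' a * (g₁ - algebraMap S S' G₁) + algebraMap S S' b * (g₂ - algebraMap S S' G₂)) := by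
    simp only [map_add, map_mul]
    ring
  have hab' := h.2.2 (algebraMap S S' a) (algebraMap S S' b) (by
    rw [hsplit]
    exact Ideal.add_mem _ hup (Ideal.add_mem _ (Ideal.mul_mem_left _ _ h₁) (Ideal.mul_mem_left _ _ h₂)))
  exact ⟨hone a hab'.1, hone b hab'.2⟩

variable (hdense : ∀ (n : ℕ) (y : S'), ∃ x : S, y - algebraMap S S' x ∈ maximalIdeal S' ^ n)

include hdense

omit [Module.Flat S S'] in
/-- **Every upstairs piece is extended from downstairs**: for a pair `(g₁, g₂)` upstairs and a degree `n` there are `G₁, G₂` downstairs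
with `gᵢ ≡ Gᵢ·1 (mod 𝔪′^{max n 2})` and `F_{g₁,g₂}(n) = F_{G₁,G₂}(n)·S′`. [folklore] -/
theorem exists_flagContactFiltration_eq_map_of_dense (g₁ g₂ : S') (q r₁ r₂ n : ℕ) :
    ∃ G₁ G₂ : S, g₁ - algebraMap S S' G₁ ∈ maximalIdeal S' ^ max n 2 ∧ g₂ - algebraMap S S' G₂ ∈ maximalIdeal S' ^ max n 2 ∧
      flagContactFiltration g₁ g₂ q r₁ r₂ n = (flagContactFiltration G₁ G₂ q r₁ r₂ n).map (algebraMap S S') := by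
  obtain ⟨G₁, h₁⟩ := hdense (max n 2) g₁
  obtain ⟨G₂, h₂⟩ := hdense (max n 2) g₂
  refine ⟨G₁, G₂, h₁, h₂, ?_⟩
  rw [map_flagContactFiltration_eq (algebraMap S S') hm,
    flagContactFiltration_eq_of_sub_mem_pow (le_max_left n 2) h₁ h₂]

/-- **DESCENT OF REACHED WEIGHTS** (the open half of (o39) for this class): `FlagReaches (f·1) ν q r₁ r₂ → FlagReaches f ν q r₁ r₂`.
(Approximate the upstairs flag modulo `𝔪′^{max(r₁ν, 2)}` by a downstairs pair: it is a two-flag by `IsTwoFlag.of_sub_mem_sq`, its piece extends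
to the upstairs piece by the jets lemma, and membership descends by faithful flatness.) [folklore] -/
theorem FlagReaches.of_dense {f : S} {ν q r₁ r₂ : ℕ} (h : FlagReaches (algebraMap S S' f) ν q r₁ r₂) : FlagReaches f ν q r₁ r₂ := by
  obtain ⟨g₁, g₂, hfl, hmem⟩ := h
  obtain ⟨G₁, G₂, h₁, h₂, heq⟩ := exists_flagContactFiltration_eq_map_of_dense hm hdense g₁ g₂ q r₁ r₂ (r₁ * ν)
  have hsq : maximalIdeal S' ^ max (r₁ * ν) 2 ≤ maximalIdeal S' ^ 2 := Ideal.pow_le_pow_right (le_max_right _ _)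
  refine ⟨G₁, G₂, hfl.of_sub_mem_sq hm (hsq h₁) (hsq h₂), ?_⟩
  rw [mem_iff_algebraMap_mem_map_of_flat hm, ← heq]
  exact hmem

/-- `FlagReaches` is an `iff` along the class. [folklore] -/
theorem flagReaches_algebraMap_iff_of_dense (f : S) (ν q r₁ r₂ : ℕ) :
    FlagReaches (algebraMap S S' f) ν q r₁ r₂ ↔ FlagReaches f ν q r₁ r₂ :=
  flagReaches_algebraMap_iff_of_descent hm (fun _ _ _ _ h => h.of_dense hm hdense) ν q r₁ r₂

/-- **`σ₁` is preserved** along dense flat local maps with `𝔪S′ = 𝔪′`. [folklore] -/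
theorem sigmaRatioNat_algebraMap_eq_of_dense (f : S) : sigmaRatioNat (algebraMap S S' f) = sigmaRatioNat f :=
  sigmaRatioNat_algebraMap_eq_of_descent hm fun _ _ _ _ h => h.of_dense hm hdense

/-- The level set is preserved. [folklore] -/
theorem levelSet_algebraMap_eq_of_dense (f : S) : levelSet (algebraMap S S' f) = levelSet f :=
  levelSet_algebraMap_eq_of_descent hm fun _ _ _ _ h => h.of_dense hm hdense

/-- **`σ₂` (finite part) is preserved**. [folklore] -/
theorem sigmaLevelNat_algebraMap_eq_of_dense (f : S) : sigmaLevelNat (algebraMap S S' f) = sigmaLevelNat f :=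
  sigmaLevelNat_algebraMap_eq_of_descent hm fun _ _ _ _ h => h.of_dense hm hdense

end Dense

/-! ## §2′ The ordinal letter and σ-maximising flags (`Type`-valued carriers, as the clause vocabulary) -/

section DenseType

variable {S S' : Type} [CommRing S] [CommRing S'] [IsLocalRing S] [IsLocalRing S'] [Algebra S S'] [Module.Flat S S']
  (hm : (maximalIdeal S).map (algebraMap S S') = maximalIdeal S')
  (hdense : ∀ (n : ℕ) (y : S'), ∃ x : S, y - algebraMap S S' x ∈ maximalIdeal S' ^ n)

include hm

/-- **σ-maximising flags are detected upstairs**: for `f, G₁, G₂` downstairs, `(G₁·1, G₂·1; q, r₁, r₂)` is σ-maximising for `f·1` iff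
`(G₁, G₂; q, r₁, r₂)` is σ-maximising for `f`. [folklore] -/
theorem IsSigmaMaximiser.algebraMap_iff_of_dense
    (hdense : ∀ (n : ℕ) (y : S'), ∃ x : S, y - algebraMap S S' x ∈ maximalIdeal S' ^ n)
    {f G₁ G₂ : S} {ν q r₁ r₂ : ℕ} :
    IsSigmaMaximiser (algebraMap S S' f) ν (algebraMap S S' G₁) (algebraMap S S' G₂) q r₁ r₂ ↔
      IsSigmaMaximiser f ν G₁ G₂ q r₁ r₂ := by
  constructor
  · rintro ⟨hadm, hfl, hmem, hmax⟩
    refine ⟨hadm, hfl.of_sub_mem_sq hm (by rw [sub_self]; exact Ideal.zero_mem _)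
      (by rw [sub_self]; exact Ideal.zero_mem _), ?_, fun q' r₁' r₂' hadm' hreach => hmax q' r₁' r₂' hadm'
        (hreach.algebraMap_of_flat hm)⟩
    rw [mem_iff_algebraMap_mem_map_of_flat hm, map_flagContactFiltration_eq (algebraMap S S') hm]
    exact hmem
  · rintro ⟨hadm, hfl, hmem, hmax⟩
    exact ⟨hadm, hfl.algebraMap_of_flat hm, map_mem_flagContactFiltration (algebraMap S S') hm.le hmem,
      fun q' r₁' r₂' hadm' hreach => hmax q' r₁' r₂' hadm' (hreach.of_dense hm hdense)⟩

include hdense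

/-- **σ-maximising flags are formal**: a σ-maximising flag `(g₁, g₂; q, r₁, r₂)` of `f·1` upstairs is congruent to any prescribed order
`𝔪′ᴺ` (`N ≥ max(r₁ν, 2)`) to the image of a σ-maximising flag `(G₁, G₂; q, r₁, r₂)` of `f` downstairs. [folklore] -/
theorem exists_isSigmaMaximiser_of_dense {f : S} {ν q r₁ r₂ : ℕ} {g₁ g₂ : S'}
    (h : IsSigmaMaximiser (algebraMap S S' f) ν g₁ g₂ q r₁ r₂) {N : ℕ} (hN : max (r₁ * ν) 2 ≤ N) :
    ∃ G₁ G₂ : S, g₁ - algebraMap S S' G₁ ∈ maximalIdeal S' ^ N ∧ g₂ - algebraMap S S' G₂ ∈ maximalIdeal S' ^ N ∧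
      IsSigmaMaximiser f ν G₁ G₂ q r₁ r₂ := by
  obtain ⟨hadm, hfl, hmem, hmax⟩ := h
  obtain ⟨G₁, h₁⟩ := hdense N g₁
  obtain ⟨G₂, h₂⟩ := hdense N g₂
  have hsq : maximalIdeal S' ^ N ≤ maximalIdeal S' ^ 2 := Ideal.pow_le_pow_right ((le_max_right _ _).trans hN)
  refine ⟨G₁, G₂, h₁, h₂, hadm, hfl.of_sub_mem_sq hm (hsq h₁) (hsq h₂), ?_,
    fun q' r₁' r₂' hadm' hreach => hmax q' r₁' r₂' hadm' (hreach.algebraMap_of_flat hm)⟩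
  rw [mem_iff_algebraMap_mem_map_of_flat hm, map_flagContactFiltration_eq (algebraMap S S') hm,
    ← flagContactFiltration_eq_of_sub_mem_pow ((le_max_left _ _).trans hN) h₁ h₂]
  exact hmem

/-- **`σ` IS PRESERVED along dense flat local maps with `𝔪S′ = 𝔪′`** — (c11σ) for this class, both halves. [folklore] -/
theorem iotaSigma_algebraMap_eq_of_dense (f : S) : iotaSigma S' (algebraMap S S' f) = iotaSigma S f :=
  iotaSigma_algebraMap_eq_of_descent hm fun _ _ _ _ h => h.of_dense hm hdense

end DenseType

/-! ## §3 The `𝔪`-adic completion is in the class -/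

section Completion

variable (S : Type u) [CommRing S] [IsLocalRing S] [IsNoetherianRing S]

/-- `𝔪·Ŝ = 𝔪̂` (Mathlib). [cite: Matsumura1987, Thm. 8.10] -/
theorem map_maximalIdeal_adicCompletion :
    (maximalIdeal S).map (algebraMap S (AdicCompletion (maximalIdeal S) S)) = maximalIdeal (AdicCompletion (maximalIdeal S) S) :=
  (AdicCompletion.maximalIdeal_eq_map (R := S)).symm

/-- **The completion is DENSE**: every element of `Ŝ` is congruent modulo `𝔪̂ⁿ` to an element of `S`. [cite: Matsumura1987, Thm. 8.10] -/
theorem adicCompletion_dense (n : ℕ) (y : AdicCompletion (maximalIdeal S) S) :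
    ∃ x : S, y - algebraMap S (AdicCompletion (maximalIdeal S) S) x ∈ maximalIdeal (AdicCompletion (maximalIdeal S) S) ^ n := by
  have fg := (maximalIdeal S).fg_of_isNoetherianRing
  obtain ⟨x, hx⟩ := Ideal.Quotient.mk_surjective (y.1 n)
  refine ⟨x, ?_⟩
  rw [AdicCompletion.maximalIdeal_eq_map, ← Ideal.map_pow, ← Submodule.restrictScalars_mem S, ← Ideal.smul_top_eq_map,
    ← Submodule.neg_mem_iff, neg_sub, AdicCompletion.algebraMap_apply, AdicCompletion.pow_smul_top_eq_ker_eval fg]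
  simpa [AdicCompletion.eval, sub_eq_zero] using hx

end Completion

section CompletionType

variable (S : Type) [CommRing S] [IsLocalRing S] [IsNoetherianRing S]

/-- **Reached weights are formal**: `FlagReaches` for `f` in `S` iff for its image in the `𝔪`-adic completion. [folklore] -/
theorem flagReaches_adicCompletion_iff (f : S) (ν q r₁ r₂ : ℕ) :
    FlagReaches (algebraMap S (AdicCompletion (maximalIdeal S) S) f) ν q r₁ r₂ ↔ FlagReaches f ν q r₁ r₂ :=
  flagReaches_algebraMap_iff_of_dense (map_maximalIdeal_adicCompletion S) (adicCompletion_dense S) f ν q r₁ r₂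

/-- **`σ` IS FORMAL**: `iotaSigma Ŝ (f·1) = iotaSigma S f` for the `𝔪`-adic completion of a Noetherian local ring. [folklore] -/
theorem iotaSigma_adicCompletion_eq (f : S) :
    iotaSigma (AdicCompletion (maximalIdeal S) S) (algebraMap S (AdicCompletion (maximalIdeal S) S) f) = iotaSigma S f :=
  iotaSigma_algebraMap_eq_of_dense (map_maximalIdeal_adicCompletion S) (adicCompletion_dense S) f

/-- σ-maximising flags in the completion come, to any order, from σ-maximising flags of `S`. [folklore] -/
theorem exists_isSigmaMaximiser_of_adicCompletion {f : S} {ν q r₁ r₂ : ℕ} {g₁ g₂ : AdicCompletion (maximalIdeal S) S}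
    (h : IsSigmaMaximiser (algebraMap S _ f) ν g₁ g₂ q r₁ r₂) {N : ℕ} (hN : max (r₁ * ν) 2 ≤ N) :
    ∃ G₁ G₂ : S, g₁ - algebraMap S _ G₁ ∈ maximalIdeal _ ^ N ∧ g₂ - algebraMap S _ G₂ ∈ maximalIdeal _ ^ N ∧
      IsSigmaMaximiser f ν G₁ G₂ q r₁ r₂ :=
  exists_isSigmaMaximiser_of_dense (map_maximalIdeal_adicCompletion S) (adicCompletion_dense S) h hN

end CompletionType

end Iota3

end Summit.ResolutionOfSingularities.ResolutionOfSingularities.Cruxes.HypersurfaceCentreConstruction.LocalEngine
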